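import Mathlib
import HarnessLib
import Summits.NavierStokesRegularity.NavierStokesRegularity.Theorems.EulerZoomLiouvillePowerGaugeEulerLiouvilleSelfSimilarBernoulliThinness

/-!
# Crux E `PowerGaugeEulerLiouville` (stmt-NavierStokesRegularity-19832) — (F3) SHELL BUDGETS WITH FREE
# THRESHOLDS (companion of `…SelfSimilarBernoulliThinness`; RESIDUE-MEMO-19832-g11 §0 (F3))

Width-seat file (prover ns-sz-p1 g4, 19832 pool).  The two Chebyshev steps inside
`BernoulliThinness.volume_bernoulliHigh_inter_shell_le`, restated as public lemmas with FREE thresholds,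
exactly as the LEAD's residue memo (F3) quotes them:

* `volume_pressureHigh_inter_shell_le` — `∫ |P|^{3/2}|y|^{2ρ−2} ≤ C`, `ρ ≤ 1`, `b, L > 0`:
  `|{L ≤ |y| ≤ 2L, b|y|² ≤ P(y)}| ≤ max C 0 /(b^{3/2} 2^{2ρ−2}) · L^{−1−2ρ}`;
* `volume_velocityHigh_inter_ball_le` — `∫_{B_L}|V|² ≤ c L^{1−2ρ}` (all `L > 0`), `a, L > 0`:
  `|{|y| ≤ 2L, aL ≤ |V(y)|}| ≤ c 3^{1−2ρ}/a² · L^{−1−2ρ}`.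

Elementary (Chebyshev via `BernoulliThinness.measure_le_lintegral_div`); no profile equation is used.
HONEST FRAMING: by-name helpers (`--supports … --as helper`); crux E 19832, its lines and the summit are
OPEN; nothing here is credited toward them.
-/

noncomputable section

set_option linter.dupNamespace false

namespace Summit.NavierStokesRegularity.NavierStokesRegularity.Theorems.PowerGaugeEulerLiouville.BernoulliShellBudget

open MeasureTheory Set Filter Topology Metric Function InnerProductSpace
open scoped RealInnerProductSpace NNReal ENNReal
open Literature.Analysis Literature.Analysis.FluidPDE
open Summit.NavierStokesRegularity.NavierStokesRegularity.Theorems.PowerGaugeEulerLiouville.BernoulliThinness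

/-! ### (F3) shell Chebyshev bounds with free thresholds -/

/-- **(F3) pressure budget on a shell, free threshold.**  `∫ |P|^{3/2}|y|^{2ρ−2} ≤ C` with `ρ ≤ 1`:
for `b, L > 0`, `|{L ≤ |y| ≤ 2L, b|y|² ≤ P}| ≤ max C 0 /(b^{3/2} 2^{2ρ−2}) · L^{−1−2ρ}`. -/
theorem volume_pressureHigh_inter_shell_le {ρ : ℝ} (hρ1 : ρ ≤ 1)
    {P : EuclideanSpace ℝ (Fin 3) → ℝ} (hPm : AEStronglyMeasurable P volume) {C : ℝ}
    (hD : ∫⁻ y, ‖P y‖ₑ ^ (3 / 2 : ℝ) * ENNReal.ofReal (‖y‖ ^ (2 * ρ - 2)) ≤ ENNReal.ofReal C)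
    {b L : ℝ} (hb : 0 < b) (hL : 0 < L) :
    volume {y : EuclideanSpace ℝ (Fin 3) | L ≤ ‖y‖ ∧ ‖y‖ ≤ 2 * L ∧ b * ‖y‖ ^ 2 ≤ P y} ≤
      ENNReal.ofReal (max C 0 / (b ^ (3 / 2 : ℝ) * 2 ^ (2 * ρ - 2)) * L ^ (-1 - 2 * ρ)) := by
  set Cp : ℝ := max C 0 with hCp
  have hD' : ∫⁻ y, ‖P y‖ₑ ^ (3 / 2 : ℝ) * ENNReal.ofReal (‖y‖ ^ (2 * ρ - 2)) ≤ ENNReal.ofReal Cp :=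
    hD.trans (ENNReal.ofReal_le_ofReal (le_max_left _ _))
  set k₁ : ℝ := b ^ (3 / 2 : ℝ) * (2 : ℝ) ^ (2 * ρ - 2) with hk₁
  have hk₁pos : 0 < k₁ := by positivity
  set f : EuclideanSpace ℝ (Fin 3) → ℝ≥0∞ := fun y =>
    ‖P y‖ₑ ^ (3 / 2 : ℝ) * ENNReal.ofReal (‖y‖ ^ (2 * ρ - 2)) with hf
  have hfm : AEMeasurable f volume :=
    (hPm.aemeasurable.enorm.pow_const _).mul
      ((measurable_norm.pow_const _).ennreal_ofReal.aemeasurable)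
  set lamP : ℝ≥0∞ := ENNReal.ofReal (k₁ * L ^ (1 + 2 * ρ)) with hlamP
  have hlamP0 : lamP ≠ 0 := (ENNReal.ofReal_pos.2 (by positivity)).ne'
  have hSP : volume {y : EuclideanSpace ℝ (Fin 3) | L ≤ ‖y‖ ∧ ‖y‖ ≤ 2 * L ∧ b * ‖y‖ ^ 2 ≤ P y} ≤
      ENNReal.ofReal Cp / lamP := by
    refine (measure_le_lintegral_div hfm hlamP0 ENNReal.ofReal_ne_top fun y hy => ?_).trans
      (ENNReal.div_le_div_right hD' _)
    obtain ⟨hyL, hy2L, hP⟩ := hy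
    have hyn : 0 < ‖y‖ := lt_of_lt_of_le hL hyL
    have hPy : b * L ^ 2 ≤ ‖P y‖ := by
      have : b * L ^ 2 ≤ b * ‖y‖ ^ 2 :=
        mul_le_mul_of_nonneg_left (pow_le_pow_left₀ hL.le hyL 2) hb.le
      exact this.trans (hP.trans (Real.le_norm_self _))
    have hw : (2 * L) ^ (2 * ρ - 2) ≤ ‖y‖ ^ (2 * ρ - 2) :=
      Real.rpow_le_rpow_of_nonpos hyn hy2L (by linarith)
    rw [hf]; dsimp only
    rw [hlamP]
    have e : k₁ * L ^ (1 + 2 * ρ) = (b * L ^ 2) ^ (3 / 2 : ℝ) * (2 * L) ^ (2 * ρ - 2) := by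
      rw [hk₁, Real.mul_rpow hb.le (by positivity), Real.mul_rpow (by norm_num) hL.le]
      have e3 : (L ^ 2) ^ (3 / 2 : ℝ) = L ^ (3 : ℝ) := by
        rw [← Real.rpow_natCast L 2, ← Real.rpow_mul hL.le]; norm_num
      rw [e3]
      have e4 : L ^ (1 + 2 * ρ) = L ^ (3 : ℝ) * L ^ (2 * ρ - 2) := by
        rw [← Real.rpow_add hL]; ring_nf
      rw [e4]; ring
    rw [e, ENNReal.ofReal_mul (by positivity)]
    refine mul_le_mul' ?_ (ENNReal.ofReal_le_ofReal hw)
    calc ENNReal.ofReal ((b * L ^ 2) ^ (3 / 2 : ℝ))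
        = ENNReal.ofReal (b * L ^ 2) ^ (3 / 2 : ℝ) := by
          rw [ENNReal.ofReal_rpow_of_nonneg (by positivity) (by norm_num)]
      _ ≤ ‖P y‖ₑ ^ (3 / 2 : ℝ) := by
          refine ENNReal.rpow_le_rpow ?_ (by norm_num)
          rw [← ofReal_norm]
          exact ENNReal.ofReal_le_ofReal hPy
  have hneg : L ^ (-1 - 2 * ρ) = (L ^ (1 + 2 * ρ))⁻¹ := by
    rw [show (-1 - 2 * ρ : ℝ) = -(1 + 2 * ρ) by ring, Real.rpow_neg hL.le]
  have hLpow : 0 < L ^ (1 + 2 * ρ) := Real.rpow_pos_of_pos hL _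
  have hP' : ENNReal.ofReal Cp / lamP = ENNReal.ofReal (Cp / k₁ * L ^ (-1 - 2 * ρ)) := by
    rw [hlamP, ← ENNReal.ofReal_div_of_pos (by positivity)]
    congr 1
    rw [hneg]
    field_simp
  rw [← hP']
  exact hSP

/-- **(F3) energy budget on a ball, free threshold.**  `∫_{B_L} |V|² ≤ c L^{1−2ρ}` for all `L > 0`:
for `a, L > 0`, `|{|y| ≤ 2L, aL ≤ |V y|}| ≤ c 3^{1−2ρ}/a² · L^{−1−2ρ}` (Chebyshev on `B_{3L}`). -/
theorem volume_velocityHigh_inter_ball_le {ρ : ℝ}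
    {V : EuclideanSpace ℝ (Fin 3) → EuclideanSpace ℝ (Fin 3)} (hVm : AEStronglyMeasurable V volume)
    {c : ℝ≥0}
    (hA : ∀ L : ℝ, 0 < L → ∫⁻ y in ball (0 : EuclideanSpace ℝ (Fin 3)) L, ‖V y‖ₑ ^ 2 ≤
      c * ENNReal.ofReal (L ^ (1 - 2 * ρ)))
    {a L : ℝ} (ha : 0 < a) (hL : 0 < L) :
    volume {y : EuclideanSpace ℝ (Fin 3) | ‖y‖ ≤ 2 * L ∧ a * L ≤ ‖V y‖} ≤
      ENNReal.ofReal ((c : ℝ) * 3 ^ (1 - 2 * ρ) / a ^ 2 * L ^ (-1 - 2 * ρ)) := by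
  set k₂ : ℝ := (c : ℝ) * (3 : ℝ) ^ (1 - 2 * ρ) / a ^ 2 with hk₂
  set g : EuclideanSpace ℝ (Fin 3) → ℝ≥0∞ :=
    (ball (0 : EuclideanSpace ℝ (Fin 3)) (3 * L)).indicator fun y => ‖V y‖ₑ ^ 2 with hg
  have hgm : AEMeasurable g volume := (hVm.aemeasurable.enorm.pow_const _).indicator measurableSet_ball
  have hgint : ∫⁻ y, g y = ∫⁻ y in ball (0 : EuclideanSpace ℝ (Fin 3)) (3 * L), ‖V y‖ₑ ^ 2 := by
    rw [hg, lintegral_indicator measurableSet_ball]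
  set lamV : ℝ≥0∞ := ENNReal.ofReal ((a * L) ^ 2) with hlamV
  have hlamV0 : lamV ≠ 0 := (ENNReal.ofReal_pos.2 (by positivity)).ne'
  have hSV : volume {y : EuclideanSpace ℝ (Fin 3) | ‖y‖ ≤ 2 * L ∧ a * L ≤ ‖V y‖} ≤
      (c * ENNReal.ofReal ((3 * L) ^ (1 - 2 * ρ))) / lamV := by
    refine (measure_le_lintegral_div hgm hlamV0 ENNReal.ofReal_ne_top fun y hy => ?_).trans ?_
    · obtain ⟨hy2L, hVy⟩ := hy
      have hyb : y ∈ ball (0 : EuclideanSpace ℝ (Fin 3)) (3 * L) := by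
        rw [mem_ball, dist_zero_right]; linarith
      rw [hg, indicator_of_mem hyb, hlamV, ← ofReal_norm, ← ENNReal.ofReal_pow (norm_nonneg _)]
      exact ENNReal.ofReal_le_ofReal (pow_le_pow_left₀ (by positivity) hVy 2)
    · rw [hgint]
      exact ENNReal.div_le_div_right (hA (3 * L) (by positivity)) _
  have hV' : (c * ENNReal.ofReal ((3 * L) ^ (1 - 2 * ρ))) / lamV =
      ENNReal.ofReal (k₂ * L ^ (-1 - 2 * ρ)) := by
    rw [hlamV, ← ENNReal.ofReal_coe_nnreal, ← ENNReal.ofReal_mul (NNReal.coe_nonneg c),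
      ← ENNReal.ofReal_div_of_pos (by positivity)]
    congr 1
    rw [hk₂, Real.mul_rpow (by norm_num) hL.le]
    have e1 : L ^ (1 - 2 * ρ) = L ^ (-1 - 2 * ρ) * L ^ 2 := by
      rw [← Real.rpow_natCast L 2, ← Real.rpow_add hL]; congr 1; push_cast; ring
    rw [e1]
    field_simp
  rw [← hV']
  exact hSV

end Summit.NavierStokesRegularity.NavierStokesRegularity.Theorems.PowerGaugeEulerLiouville.BernoulliShellBudget

end
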